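import Summits.Parity.GeneralizedHardyLittlewood.Theorems.BeyondDiagonalBeatsQuarter.OffDiagDualSwitchForm
import Summits.Parity.GeneralizedHardyLittlewood.Theorems.BeyondDiagonalBeatsQuarter.OffDiagLevelAP
import HarnessLib

/-!
# Route `PrimeLevelFamEdge`, crux K_B (stmt-Parity-20343), line `diagonal_kernel_split` rev 4, plan Ω,
# KEYS-NEXT S3, part 1 (OMEGA-BLUEPRINT L6′) — **the BLOCK SWITCH:
# the sum over the prime levels `q` of a block of the (truncated) dual series of a box, exchanged with the
# switched dual variables `(h₁, s)` (truncated series = finite sum of switched `s`-series; finite exchange)**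

After Ω-h v4 (`OffDiagHeartCore`, p643105) the heart is a block bound for the finite dual core: for each level
`q ∈ goodPrimes Δ′ N` a finite sum (over `r < q⁷`, `l, m`, `d₁∣l`, `d₂∣m`, `i ∈ nearBoxes`) of dual series
`Σ_{h∈ℤ², |h₁| ≤ H} Φ̂_i(h/C)·N_C(a,b;h)`, `C = q(r+1)`, `a = l/d₁` a unit mod `C`, `b = m/d₂`.
`OffDiagDualSwitchForm.tsum_dual_eq_tsum_switch` (p641894) writes ONE complete dual series in `(h₁,s)`-form. This
file supplies the series-level steps between that identity and the class split `OffDiagLevelAP`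
(GATE G2 §(a) a8 = a8P + a8R + a8S), with every summability discharged from the dual family itself:

* §1 `summable_hyperbola_iff_summable_switch` — summability transfers through the divisor switch `h₂ ↔ s`
  (the support bijection of `OffDiagDivisorSwitchSeries.tsum_hyperbola_eq_tsum_switch`);
* §2 `tsum_fiber_dual_eq_switch`, `summable_switch_of_summable_fiber`, `tsum_dual_eq_tsum_switch_weight` — the
  switch for a GENERAL weight `F(h₁,h₂)` (so that truncations `𝟙[|h₁| ≤ H]` ride along), fiber by fiber, with the
  `s`-summability of the switched family obtained from the `h₂`-fiber of the dual family;
* §3 `tsum_trunc_dual_eq_sum_switch`, `tsum_trunc_dual_eq_sum_switch_fourier2` — the `|h₁| ≤ H`-TRUNCATED dual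
  series (the summand shape of `offDiagCore`) is a FINITE sum over `h₁ ∈ [−H, H]` of switched `s`-series, the second
  frequency in the shifted-lattice form `s/h₁ + ab/(h₁C)`; `sum_Icc_eq_sum_Icc_ite_of_le` enlarges `[−H_q, H_q]` to a
  common range;
* §4 `sum_levels_sum_tsum_switch_eq` — **the block switch**: for a finite set of levels `G` and a common finite
  range `B` of dual moduli, `Σ_{q∈G} Σ_{h₁∈B} 𝟙[U q h₁]·Σ'_s 𝟙[D q h₁ s]·g = Σ_{h₁∈B} Σ'_s Σ_{q∈G} 𝟙[U]𝟙[D]·g`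
  (finite exchange in `h₁`, `Summable.tsum_finsetSum` in `s`);
* the identification of the inner level sum `Σ_{q∈G} 𝟙[U]𝟙[D]·g` (fixed `(h₁, s)`) with a `levelAPSum` to modulus
  `|h₁|` — generic stratum `(cs,h₁) = 1`, reduced modulus `|h₁|/gcd(cs,h₁)` otherwise — is the companion file
  `OffDiagBlockStrata` (pure `ℤ`/`ZMod` algebra, no series).

What is NOT here: the doubly non-coprime frequency stratum (`a` AND `b` non-units mod `C`, where neither switched form
applies — gcd bounds `OffDiagDualCountStrata`), the separation of the `q`-dependence of the ranges `r < q⁷`, `l,m ≤ q̂^{Δ′}`,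
`i ∈ nearBoxes q …` (L7c), and any estimate (L6/L7/L8). Pure algebra over landed identities; theorems only; standard
axioms. Helper toward `stub_offDiagBelowSlack_io`; closes nothing.
«The programme SEARCHES and TYPES; no claim about Landau–Siegel zeros, Theorems 1–2 of arXiv:2211.02515 or
a repaired Margin232 until a kernel theorem says so.»
-/

noncomputable section

open Finset
open scoped Real FourierTransform

namespace Summit.Parity.GeneralizedHardyLittlewood.Theorems.BeyondDiagonalBeatsQuarter.OffDiag

open Literature.NumberTheory.Sieve.FriedlanderIwaniecPrimes (fourier2)
open OffDiagDual (dualCount_eq_ite_of_isUnit)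

/-! ### §1. Summability transfers through the divisor switch -/

/-- **Summability through the divisor switch.** For `C ≥ 1`, `h₁ ≠ 0`, integers `a, b` and any `F : ℤ → M`:
the hyperbola-indicator family `h₂ ↦ 𝟙[h₁h₂ ≡ ab (mod C)]·F(h₂)` is summable iff the switched family
`s ↦ 𝟙[h₁ ∣ ab + Cs]·F((ab + Cs)/h₁)` is (their supports correspond under `s = (h₁h₂ − ab)/C`, `h₂ = (ab + Cs)/h₁`,
exactly as in `tsum_hyperbola_eq_tsum_switch`). [folklore] -/
theorem summable_hyperbola_iff_summable_switch {M : Type*} [AddCommMonoid M] [TopologicalSpace M]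
    {C : ℕ} (hC : 1 ≤ C) {a b h₁ : ℤ} (hh₁ : h₁ ≠ 0) (F : ℤ → M) :
    Summable (fun h₂ : ℤ ↦
        if (h₁ : ZMod C) * (h₂ : ZMod C) = (a : ZMod C) * (b : ZMod C) then F h₂ else 0) ↔
      Summable (fun s : ℤ ↦
        if h₁ ∣ a * b + (C : ℤ) * s then F ((a * b + (C : ℤ) * s) / h₁) else 0) := by
  classical
  have hC' : (C : ℤ) ≠ 0 := by exact_mod_cast (show C ≠ 0 by omega)
  have key : ∀ x : M,
      HasSum (fun h₂ : ℤ ↦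
        if (h₁ : ZMod C) * (h₂ : ZMod C) = (a : ZMod C) * (b : ZMod C) then F h₂ else 0) x ↔
      HasSum (fun s : ℤ ↦
        if h₁ ∣ a * b + (C : ℤ) * s then F ((a * b + (C : ℤ) * s) / h₁) else 0) x := by
    intro x
    refine hasSum_iff_hasSum_of_ne_zero_bij
      (g := fun s : ℤ ↦ (if h₁ ∣ a * b + (C : ℤ) * s then F ((a * b + (C : ℤ) * s) / h₁) else 0))
      (fun s ↦ (a * b + (C : ℤ) * (s : ℤ)) / h₁) ?_ ?_ ?_
    · -- injective on the support
      rintro ⟨s, hs⟩ ⟨s', hs'⟩ h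
      simp only [Function.mem_support, ne_eq, ite_eq_right_iff, Classical.not_imp] at hs hs'
      obtain ⟨⟨t, ht⟩, -⟩ := hs
      obtain ⟨⟨t', ht'⟩, -⟩ := hs'
      simp only [Subtype.mk.injEq]
      simp only at h
      rw [ht, ht', Int.mul_ediv_cancel_left _ hh₁, Int.mul_ediv_cancel_left _ hh₁] at h
      subst h
      have : (C : ℤ) * s = (C : ℤ) * s' := by linarith
      exact mul_left_cancel₀ hC' this
    · -- the support of the `h₂`-family is in the range
      intro h₂ hh₂
      simp only [Function.mem_support, ne_eq, ite_eq_right_iff, Classical.not_imp] at hh₂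
      obtain ⟨hcong, hF⟩ := hh₂
      obtain ⟨s, hs⟩ := (intCast_mul_eq_iff_exists a b h₁ h₂).mp hcong
      have hdvd : h₁ ∣ a * b + (C : ℤ) * s := ⟨h₂, by rw [← hs, mul_comm]⟩
      have hval : (a * b + (C : ℤ) * s) / h₁ = h₂ := by rw [← hs, mul_comm, Int.mul_ediv_cancel _ hh₁]
      refine ⟨⟨s, ?_⟩, hval⟩
      simp only [Function.mem_support, ne_eq, ite_eq_right_iff, Classical.not_imp]
      exact ⟨hdvd, by rwa [hval]⟩
    · -- values agree
      rintro ⟨s, hs⟩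
      have hd : h₁ ∣ a * b + (C : ℤ) * s := by
        by_contra hnd
        exact hs (by simp only [if_neg hnd])
      obtain ⟨t, ht⟩ := hd
      have hval : (a * b + (C : ℤ) * s) / h₁ = t := by rw [ht, Int.mul_ediv_cancel_left _ hh₁]
      have hcong : (h₁ : ZMod C) * (t : ZMod C) = (a : ZMod C) * (b : ZMod C) := by
        rw [intCast_mul_eq_iff_exists]
        exact ⟨s, by rw [← ht]⟩
      simp only [hval, if_pos hcong, if_pos (show h₁ ∣ a * b + (C : ℤ) * s from ⟨t, ht⟩)]
  exact ⟨fun ⟨x, hx⟩ ↦ ⟨x, (key x).mp hx⟩, fun ⟨x, hx⟩ ↦ ⟨x, (key x).mpr hx⟩⟩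

/-! ### §2. The switch for a general weight, fiber by fiber

Decidability of `h₁ unit mod C` is taken as a HYPOTHESIS (`[∀ h₁, Decidable …]`) in every statement that displays
the indicator `𝟙[h₁ unit]`, so that the lemmas rewrite per level (where `NeZero (q(r+1))` gives the finite instance)
as well as under a sum over the levels of a block (where only the classical instance is available). -/

section Weight

variable {C : ℕ} [NeZero C]

/-- **One fiber of the dual series in switched form (general weight).** For `C ≥ 2`, `a` a unit mod `C`, any `b`,
any weight `F : ℤ → ℤ → ℂ` and any `h₁`:
`Σ'_{h₂} F(h₁,h₂)·N_C(a,b;h₁,h₂) = 𝟙[h₁ unit mod C]·Σ'_{s} 𝟙[h₁ ∣ ab + Cs]·F(h₁, (ab + Cs)/h₁)`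
(no summability needed: coprime stratum `N = 𝟙[h₁ unit ∧ h₁h₂ ≡ ab]` and the support re-indexing `h₂ ↔ s`).
[cite: KowalskiMichelVanderKam2000, Lemma 3.3 p. 9 — derivation] -/
theorem tsum_fiber_dual_eq_switch [∀ h₁ : ℤ, Decidable (IsUnit ((h₁ : ℤ) : ZMod C))] (hC : 2 ≤ C) {a : ℕ}
    (ha : IsUnit ((a : ℕ) : ZMod C)) (b : ℕ) (F : ℤ → ℤ → ℂ) (h₁ : ℤ) :
    ∑' h₂ : ℤ, F h₁ h₂ * (dualCount C (a : ZMod C) (b : ZMod C) (h₁ : ZMod C) (h₂ : ZMod C) : ℂ) =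
      if IsUnit ((h₁ : ℤ) : ZMod C) then
        ∑' s : ℤ, (if h₁ ∣ (a : ℤ) * b + (C : ℤ) * s then F h₁ (((a : ℤ) * b + (C : ℤ) * s) / h₁) else 0)
      else 0 := by
  by_cases hu : IsUnit ((h₁ : ℤ) : ZMod C)
  · rw [if_pos hu]
    have hh₁ : h₁ ≠ 0 := intCast_ne_zero_of_isUnit hC hu
    have hstep : ∀ h₂ : ℤ, F h₁ h₂ * (dualCount C (a : ZMod C) (b : ZMod C) (h₁ : ZMod C) (h₂ : ZMod C) : ℂ) =
        (if ((h₁ : ℤ) : ZMod C) * ((h₂ : ℤ) : ZMod C) = ((a : ℤ) : ZMod C) * ((b : ℤ) : ZMod C)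
          then F h₁ h₂ else 0) := by
      intro h₂
      rw [dualCount_eq_ite_of_isUnit ha]
      by_cases hc : ((h₁ : ℤ) : ZMod C) * ((h₂ : ℤ) : ZMod C) = (a : ZMod C) * (b : ZMod C)
      · rw [if_pos ⟨hu, hc⟩, Nat.cast_one, mul_one, if_pos (by push_cast; exact hc)]
      · rw [if_neg (fun h ↦ hc h.2), Nat.cast_zero, mul_zero, if_neg (by push_cast; exact hc)]
    simp_rw [hstep]
    exact tsum_hyperbola_eq_tsum_switch (M := ℂ) (le_trans (by norm_num) hC) hh₁ (F h₁)
  · rw [if_neg hu]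
    have hzero : ∀ h₂ : ℤ, F h₁ h₂ * (dualCount C (a : ZMod C) (b : ZMod C) (h₁ : ZMod C) (h₂ : ZMod C) : ℂ) = 0 := by
      intro h₂
      rw [dualCount_eq_ite_of_isUnit ha, if_neg (fun h ↦ hu h.1), Nat.cast_zero, mul_zero]
    simp_rw [hzero]
    exact tsum_zero

/-- **The switched `s`-family is summable whenever the `h₂`-fiber of the dual family is.** For `C ≥ 2`, `a` a unit,
`h₁` a unit mod `C` and `F(h₁,·)·N_C(a,b;h₁,·)` summable: `s ↦ 𝟙[h₁ ∣ ab + Cs]·F(h₁, (ab + Cs)/h₁)` is summable.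
(For the box weights the fiber summability is `(OffDiag.summable_dual …).prod_factor h₁`.) [folklore] -/
theorem summable_switch_of_summable_fiber (hC : 2 ≤ C) {a : ℕ} (ha : IsUnit ((a : ℕ) : ZMod C)) (b : ℕ)
    (F : ℤ → ℤ → ℂ) {h₁ : ℤ} (hu : IsUnit ((h₁ : ℤ) : ZMod C))
    (hf : Summable fun h₂ : ℤ ↦
      F h₁ h₂ * (dualCount C (a : ZMod C) (b : ZMod C) (h₁ : ZMod C) (h₂ : ZMod C) : ℂ)) :
    Summable fun s : ℤ ↦
      (if h₁ ∣ (a : ℤ) * b + (C : ℤ) * s then F h₁ (((a : ℤ) * b + (C : ℤ) * s) / h₁) else 0) := by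
  classical
  have hh₁ : h₁ ≠ 0 := intCast_ne_zero_of_isUnit hC hu
  have hfib : (fun h₂ : ℤ ↦
      F h₁ h₂ * (dualCount C (a : ZMod C) (b : ZMod C) (h₁ : ZMod C) (h₂ : ZMod C) : ℂ)) =
      fun h₂ : ℤ ↦ if ((h₁ : ℤ) : ZMod C) * ((h₂ : ℤ) : ZMod C) = ((a : ℤ) : ZMod C) * ((b : ℤ) : ZMod C)
        then F h₁ h₂ else 0 := by
    funext h₂
    rw [dualCount_eq_ite_of_isUnit ha]
    by_cases hc : ((h₁ : ℤ) : ZMod C) * ((h₂ : ℤ) : ZMod C) = (a : ZMod C) * (b : ZMod C)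
    · rw [if_pos ⟨hu, hc⟩, Nat.cast_one, mul_one, if_pos (by push_cast; exact hc)]
    · rw [if_neg (fun h ↦ hc h.2), Nat.cast_zero, mul_zero, if_neg (by push_cast; exact hc)]
  rw [hfib] at hf
  exact (summable_hyperbola_iff_summable_switch (M := ℂ) (le_trans (by norm_num) hC) hh₁ (F h₁)).mp hf

/-- **The dual series in `(h₁, s)`-form for a general weight.** For `C ≥ 2`, `a` a unit mod `C`, any `b`, any
`F : ℤ → ℤ → ℂ` with `h ↦ F(h)·N_C(a,b;h)` summable on `ℤ²`:
`Σ_{h∈ℤ²} F(h₁,h₂)·N_C(a,b;h) = Σ'_{h₁} 𝟙[h₁ unit]·Σ'_{s} 𝟙[h₁ ∣ ab + Cs]·F(h₁, (ab + Cs)/h₁)`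
(`OffDiagDualSwitchForm.tsum_dual_eq_tsum_switch` is the case `F(h₁,h₂) = Φ̂(h₁/C, h₂/C)`).
[cite: KowalskiMichelVanderKam2000, Lemma 3.3 p. 9 — derivation] -/
theorem tsum_dual_eq_tsum_switch_weight [∀ h₁ : ℤ, Decidable (IsUnit ((h₁ : ℤ) : ZMod C))] (hC : 2 ≤ C)
    {a : ℕ} (ha : IsUnit ((a : ℕ) : ZMod C)) (b : ℕ) (F : ℤ → ℤ → ℂ)
    (hS : Summable fun h : ℤ × ℤ ↦
      F h.1 h.2 * (dualCount C (a : ZMod C) (b : ZMod C) (h.1 : ZMod C) (h.2 : ZMod C) : ℂ)) :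
    ∑' h : ℤ × ℤ, F h.1 h.2 * (dualCount C (a : ZMod C) (b : ZMod C) (h.1 : ZMod C) (h.2 : ZMod C) : ℂ) =
      ∑' h₁ : ℤ, (if IsUnit ((h₁ : ℤ) : ZMod C) then
        ∑' s : ℤ, (if h₁ ∣ (a : ℤ) * b + (C : ℤ) * s then F h₁ (((a : ℤ) * b + (C : ℤ) * s) / h₁) else 0)
        else 0) := by
  rw [hS.tsum_prod]
  exact tsum_congr fun h₁ ↦ tsum_fiber_dual_eq_switch hC ha b F h₁

/-- **Summability of the outer family in switched form**: under the hypothesis of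
`tsum_dual_eq_tsum_switch_weight`, `h₁ ↦ 𝟙[h₁ unit]·Σ'_{s} 𝟙[h₁ ∣ ab + Cs]·F(h₁,(ab + Cs)/h₁)` is summable (it is
the family of fiber sums). [folklore] -/
theorem summable_switch_outer [∀ h₁ : ℤ, Decidable (IsUnit ((h₁ : ℤ) : ZMod C))] (hC : 2 ≤ C) {a : ℕ}
    (ha : IsUnit ((a : ℕ) : ZMod C)) (b : ℕ) (F : ℤ → ℤ → ℂ)
    (hS : Summable fun h : ℤ × ℤ ↦
      F h.1 h.2 * (dualCount C (a : ZMod C) (b : ZMod C) (h.1 : ZMod C) (h.2 : ZMod C) : ℂ)) :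
    Summable fun h₁ : ℤ ↦ (if IsUnit ((h₁ : ℤ) : ZMod C) then
        ∑' s : ℤ, (if h₁ ∣ (a : ℤ) * b + (C : ℤ) * s then F h₁ (((a : ℤ) * b + (C : ℤ) * s) / h₁) else 0)
        else 0) :=
  hS.prod.congr fun h₁ ↦ tsum_fiber_dual_eq_switch hC ha b F h₁

end Weight

/-! ### §3. The truncated dual series of `offDiagCore` is a finite sum of switched `s`-series -/

section Truncated

variable {C : ℕ} [NeZero C]

/-- **Truncated dual series, general weight.** For `C ≥ 2`, `a` a unit mod `C`, any `b`, `H : ℕ` and a weight `W`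
with `h ↦ W(h)·N_C(a,b;h)` summable on `ℤ²`:
`Σ_{h∈ℤ²} 𝟙[|h₁| ≤ H]·W(h₁,h₂)·N = Σ_{h₁ ∈ [−H,H]} 𝟙[h₁ unit]·Σ'_{s} 𝟙[h₁ ∣ ab + Cs]·W(h₁, (ab + Cs)/h₁)`
— a FINITE sum of switched `s`-series. [cite: KowalskiMichelVanderKam2000, Lemma 3.3 p. 9 — derivation] -/
theorem tsum_trunc_dual_eq_sum_switch [∀ h₁ : ℤ, Decidable (IsUnit ((h₁ : ℤ) : ZMod C))] (hC : 2 ≤ C)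
    {a : ℕ} (ha : IsUnit ((a : ℕ) : ZMod C)) (b : ℕ) (W : ℤ → ℤ → ℂ) (H : ℕ)
    (hS : Summable fun h : ℤ × ℤ ↦
      W h.1 h.2 * (dualCount C (a : ZMod C) (b : ZMod C) (h.1 : ZMod C) (h.2 : ZMod C) : ℂ)) :
    ∑' h : ℤ × ℤ, (if |h.1| ≤ (H : ℤ) then
        W h.1 h.2 * (dualCount C (a : ZMod C) (b : ZMod C) (h.1 : ZMod C) (h.2 : ZMod C) : ℂ) else 0) =
      ∑ h₁ ∈ Icc (-(H : ℤ)) H, (if IsUnit ((h₁ : ℤ) : ZMod C) then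
        ∑' s : ℤ, (if h₁ ∣ (a : ℤ) * b + (C : ℤ) * s then W h₁ (((a : ℤ) * b + (C : ℤ) * s) / h₁) else 0)
        else 0) := by
  -- the truncated weight
  set F : ℤ → ℤ → ℂ := fun h₁ h₂ ↦ if |h₁| ≤ (H : ℤ) then W h₁ h₂ else 0 with hF
  have hsummand : ∀ h : ℤ × ℤ, (if |h.1| ≤ (H : ℤ) then
      W h.1 h.2 * (dualCount C (a : ZMod C) (b : ZMod C) (h.1 : ZMod C) (h.2 : ZMod C) : ℂ) else 0) =
      F h.1 h.2 * (dualCount C (a : ZMod C) (b : ZMod C) (h.1 : ZMod C) (h.2 : ZMod C) : ℂ) := by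
    intro h
    simp only [hF]
    split_ifs <;> simp
  have hSF : Summable fun h : ℤ × ℤ ↦
      F h.1 h.2 * (dualCount C (a : ZMod C) (b : ZMod C) (h.1 : ZMod C) (h.2 : ZMod C) : ℂ) := by
    refine (hS.indicator {h : ℤ × ℤ | |h.1| ≤ (H : ℤ)}).congr fun h ↦ ?_
    simp only [Set.indicator_apply, Set.mem_setOf_eq, hF]
    split_ifs <;> simp
  simp_rw [hsummand]
  rw [tsum_dual_eq_tsum_switch_weight hC ha b F hSF]
  -- the outer family vanishes off `[−H, H]`
  rw [tsum_eq_sum (s := Icc (-(H : ℤ)) H)]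
  · refine Finset.sum_congr rfl fun h₁ hh₁ ↦ ?_
    rw [Finset.mem_Icc] at hh₁
    have habs : |h₁| ≤ (H : ℤ) := abs_le.mpr hh₁
    simp only [hF, if_pos habs]
  · intro h₁ hh₁
    rw [Finset.mem_Icc, ← abs_le] at hh₁
    simp only [hF, if_neg hh₁]
    simp

/-- **Truncated dual series of a box weight (the summand of `offDiagCore`), switched.** For `C ≥ 2`, `a` a unit mod
`C`, any `b`, any `Φ : ℝ → ℝ → ℂ` whose dual family is summable (box weights: `OffDiag.summable_dual`) and `H : ℕ`:
`Σ_{h∈ℤ²} 𝟙[|h₁| ≤ H]·Φ̂(h₁/C,h₂/C)·N_C(a,b;h)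
   = Σ_{h₁∈[−H,H]} 𝟙[h₁ unit mod C]·Σ'_{s∈ℤ} 𝟙[h₁ ∣ ab + Cs]·Φ̂(h₁/C, s/h₁ + ab/(h₁C))`.
[cite: KowalskiMichelVanderKam2000, Lemma 3.3 p. 9 — derivation] -/
theorem tsum_trunc_dual_eq_sum_switch_fourier2 [∀ h₁ : ℤ, Decidable (IsUnit ((h₁ : ℤ) : ZMod C))]
    (hC : 2 ≤ C) {a : ℕ} (ha : IsUnit ((a : ℕ) : ZMod C)) (b : ℕ) (Φ : ℝ → ℝ → ℂ) (H : ℕ)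
    (hS : Summable fun h : ℤ × ℤ ↦ fourier2 Φ (h.1 / C) (h.2 / C) *
      (dualCount C (a : ZMod C) (b : ZMod C) (h.1 : ZMod C) (h.2 : ZMod C) : ℂ)) :
    ∑' h : ℤ × ℤ, (if |h.1| ≤ (H : ℤ) then fourier2 Φ (h.1 / C) (h.2 / C) *
        (dualCount C (a : ZMod C) (b : ZMod C) (h.1 : ZMod C) (h.2 : ZMod C) : ℂ) else 0) =
      ∑ h₁ ∈ Icc (-(H : ℤ)) H, (if IsUnit ((h₁ : ℤ) : ZMod C) then
        ∑' s : ℤ, (if h₁ ∣ (a : ℤ) * b + (C : ℤ) * s then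
          fourier2 Φ (h₁ / C) ((s : ℝ) / h₁ + ((a : ℤ) * b : ℝ) / ((h₁ : ℝ) * C)) else 0) else 0) := by
  rw [tsum_trunc_dual_eq_sum_switch hC ha b (fun h₁ h₂ ↦ fourier2 Φ (h₁ / C) (h₂ / C)) H hS]
  refine Finset.sum_congr rfl fun h₁ _ ↦ ?_
  by_cases hu : IsUnit ((h₁ : ℤ) : ZMod C)
  · rw [if_pos hu, if_pos hu]
    have hh₁ : h₁ ≠ 0 := intCast_ne_zero_of_isUnit hC hu
    refine tsum_congr fun s ↦ ?_
    by_cases hd : h₁ ∣ (a : ℤ) * b + (C : ℤ) * s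
    · rw [if_pos hd, if_pos hd, switch_frequency_eq hh₁ hd]
      push_cast
      ring_nf
    · rw [if_neg hd, if_neg hd]
  · rw [if_neg hu, if_neg hu]

/-- **The switched `s`-series of a box weight is summable** for every unit `h₁` (from the `h₂`-fiber of the dual family,
no decay estimate needed): `s ↦ 𝟙[h₁ ∣ ab + Cs]·Φ̂(h₁/C, s/h₁ + ab/(h₁C))` is summable. [folklore] -/
theorem summable_switch_fourier2 (hC : 2 ≤ C) {a : ℕ} (ha : IsUnit ((a : ℕ) : ZMod C)) (b : ℕ)
    (Φ : ℝ → ℝ → ℂ) {h₁ : ℤ} (hu : IsUnit ((h₁ : ℤ) : ZMod C))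
    (hS : Summable fun h : ℤ × ℤ ↦ fourier2 Φ (h.1 / C) (h.2 / C) *
      (dualCount C (a : ZMod C) (b : ZMod C) (h.1 : ZMod C) (h.2 : ZMod C) : ℂ)) :
    Summable fun s : ℤ ↦ (if h₁ ∣ (a : ℤ) * b + (C : ℤ) * s then
      fourier2 Φ (h₁ / C) ((s : ℝ) / h₁ + ((a : ℤ) * b : ℝ) / ((h₁ : ℝ) * C)) else 0) := by
  have hh₁ : h₁ ≠ 0 := intCast_ne_zero_of_isUnit hC hu
  have h := summable_switch_of_summable_fiber hC ha b (fun h₁ h₂ ↦ fourier2 Φ (h₁ / C) (h₂ / C)) hu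
    (hS.prod_factor h₁)
  refine h.congr fun s ↦ ?_
  by_cases hd : h₁ ∣ (a : ℤ) * b + (C : ℤ) * s
  · simp only [if_pos hd]
    rw [switch_frequency_eq hh₁ hd]
    push_cast
    ring_nf
  · simp only [if_neg hd]

end Truncated

/-- **Enlarging the truncation range to a common one.** If `H ≤ H'` then
`Σ_{h₁∈[−H,H]} f(h₁) = Σ_{h₁∈[−H',H']} 𝟙[|h₁| ≤ H]·f(h₁)` — so level-dependent heights `H_q ≤ H'` all live on one
finite range of dual moduli. [folklore] -/
theorem sum_Icc_eq_sum_Icc_ite_of_le {M : Type*} [AddCommMonoid M] {H H' : ℕ} (hHH : H ≤ H') (f : ℤ → M) :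
    ∑ h₁ ∈ Icc (-(H : ℤ)) H, f h₁ = ∑ h₁ ∈ Icc (-(H' : ℤ)) H', (if |h₁| ≤ (H : ℤ) then f h₁ else 0) := by
  classical
  rw [← Finset.sum_filter]
  congr 1
  ext h₁
  simp only [Finset.mem_Icc, Finset.mem_filter, abs_le]
  constructor
  · rintro ⟨h1, h2⟩
    have : (H : ℤ) ≤ H' := by exact_mod_cast hHH
    exact ⟨⟨by linarith, by linarith⟩, h1, h2⟩
  · rintro ⟨-, h1, h2⟩
    exact ⟨h1, h2⟩

/-! ### §4. The block switch: exchanging the level sum with the switched dual variables -/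

/-- **The block switch (exchange of finite level sum, finite dual-modulus range, and the `s`-series).** For a finite
set of levels `G`, a finite range `B` of dual moduli, a unit predicate `U q h₁`, a divisor predicate `D q h₁ s` and
weights `g q h₁ s` such that each `s ↦ 𝟙[D q h₁ s]·g q h₁ s` with `U q h₁` is summable:
`Σ_{q∈G} Σ_{h₁∈B} 𝟙[U q h₁]·Σ'_{s} 𝟙[D q h₁ s]·g = Σ_{h₁∈B} Σ'_{s} Σ_{q∈G} 𝟙[U q h₁]·𝟙[D q h₁ s]·g`
— for each `(h₁, s)` the levels run over the `q ∈ G` satisfying the unit and divisor conditions (G2 a8: «for fixed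
`(A,c,s,d)`: `q` prime ∈ block with `q ≡ −A(cs)⁻¹ (mod d)`»). [folklore] -/
theorem sum_levels_sum_tsum_switch_eq {ι : Type*} (G : Finset ℕ) (B : Finset ι)
    (U : ℕ → ι → Prop) [∀ q h, Decidable (U q h)] (D : ℕ → ι → ℤ → Prop) [∀ q h s, Decidable (D q h s)]
    (g : ℕ → ι → ℤ → ℂ)
    (hsum : ∀ q ∈ G, ∀ h₁ ∈ B, U q h₁ → Summable fun s : ℤ ↦ if D q h₁ s then g q h₁ s else 0) :
    ∑ q ∈ G, ∑ h₁ ∈ B, (if U q h₁ then ∑' s : ℤ, (if D q h₁ s then g q h₁ s else 0) else 0) =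
      ∑ h₁ ∈ B, ∑' s : ℤ, ∑ q ∈ G, (if U q h₁ then (if D q h₁ s then g q h₁ s else 0) else 0) := by
  rw [Finset.sum_comm]
  refine Finset.sum_congr rfl fun h₁ hh₁ ↦ ?_
  -- push the unit indicator inside the `s`-series
  have hin : ∀ q ∈ G, (if U q h₁ then ∑' s : ℤ, (if D q h₁ s then g q h₁ s else 0) else 0) =
      ∑' s : ℤ, (if U q h₁ then (if D q h₁ s then g q h₁ s else 0) else 0) := by
    intro q _
    by_cases hu : U q h₁
    · simp only [if_pos hu]
    · simp only [if_neg hu, tsum_zero]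
  rw [Finset.sum_congr rfl hin]
  refine (Summable.tsum_finsetSum fun q hq ↦ ?_).symm
  by_cases hu : U q h₁
  · simp only [if_pos hu]; exact hsum q hq h₁ hh₁ hu
  · simp only [if_neg hu]; exact summable_zero

end Summit.Parity.GeneralizedHardyLittlewood.Theorems.BeyondDiagonalBeatsQuarter.OffDiag
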